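import Summits.QuantumAdvantage.AdviceFreeQNC0.SymmetricCodewords
import Summits.QuantumAdvantage.AdviceFreeQNC0.MassInequalityRegimes
import HarnessLib

/-!
# Cell qa-qnc0 (rung F-Q1, density axis): MINIMUM DISTANCES `d(C_8) = 58`, `d(C_9) = 130`, `d(C_15) = 9829` (lower
# bounds over ALL codewords, kernel) and SC₁ WITH MARGIN `σ_9 = 40` at the symmetric optimum

By the orbit-counting engine (`SymmetricCount.lean`, `SymmetricCodewords.lean`): the weight of a codeword and its
overlap with the zero set of a SYMMETRIC pattern are binomial sums `G4 p q r s`, so "every non-zero codeword has weight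
`≥ d`" and the planner's SC-margins (ROUND-12 (xi-o), (xi-w): `|A ∖ Z| − |A ∩ Z| ≥ σ_m` for every non-zero codeword `A`,
`σ_9 = 40`, `σ_15 = 1093 = d(C_15) − w(15,1)`) are finite checks, decided slice by slice (`decide +kernel`).

* `pwt_cwOf` — the weight of a codeword as `G4`;  `minWt_of_distSlices` + instances
  **`minWt_eight : ∀ Q ∈ C_8, Q ≠ 0 → 58 ≤ pwt Q`**, **`minWt_nine` (130)**, **`minWt_fifteen` (9829)** (the radius inputs of
  `RowLight` / `NearOutLemma` / `IsMinWord`; values as in ROUND-12 (xi-o): kit13/w1_orbit.py);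
* `scMargin_of_slices` + **`scMargin_nine : SCMargin 9 40 (symWord 9 true)`** (planner L30 (i) at the explicit optimum);
  the same slices decide `SCMargin 15 1093 (symWord 15 false)` (σ_15, checked locally rc 0 in ≈ 3 min of kernel time — left out
  of this file to keep its elaboration short; available on request).

WHAT THIS IS NOT: the `∀ optimal symmetric K0` forms (`SCMarginNine`) additionally need the classification of symmetric
codewords (16 words) — not here; attainment (`∃ Q, pwt Q = d`) is not proved here; MI / MULT₁ OPEN; separation NOT moved.
-/

namespace Summit.QuantumAdvantage.AdviceFreeQNC0

open Finset

namespace SymCount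

open Summit.QuantumAdvantage.AdviceFreeQNC0.MassInequality

variable {m : ℕ}

/-! ### Weights and overlaps as binomial sums -/

/-- The weight of a codeword as a binomial sum. -/
theorem pwt_cwOf (ℓ0 ℓ1 : Finset (Fin m) × Bool) :
    pwt (cwOf ℓ0 ℓ1) =
      G4 (bs ℓ0.1 ℓ1.1 (true, true)) (bs ℓ0.1 ℓ1.1 (true, false)) (bs ℓ0.1 ℓ1.1 (false, true))
        (bs ℓ0.1 ℓ1.1 (false, false)) (fun k => cwVal ℓ0.2 ℓ1.2 k) :=
  card_filter_cwOf ℓ0 ℓ1 (fun b _ => b)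

/-- Value of the symmetric word `symWord m b` at a point with block weights `k` (only the total weight matters). -/
def symVal (b : Bool) (k : ℕ × ℕ × ℕ × ℕ) : Bool :=
  sel ((k.1 + k.2.1 + k.2.2.1 + k.2.2.2) % 3) true (xor b (par (k.1 + k.2.1 + k.2.2.1 + k.2.2.2)))

/-- `symWord m b u` through the block weights of `u` (for ANY pair of coordinate sets). -/
theorem symWord_eq_symVal (b : Bool) (S0 S1 : Finset (Fin m)) (u : Fin m → Bool) :
    symWord m b u = symVal b (bw4 S0 S1 u) := by
  rw [symWord_apply, wt_eq_bw_sum S0 S1 u]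
  rfl

/-- The overlap `#{u : A u = true ∧ symWord m b u = c}` of a codeword with the symmetric word, as a binomial sum. -/
theorem card_overlap_cwOf (ℓ0 ℓ1 : Finset (Fin m) × Bool) (b c : Bool) :
    (univ.filter fun u : Fin m → Bool => cwOf ℓ0 ℓ1 u = true ∧ symWord m b u = c).card =
      G4 (bs ℓ0.1 ℓ1.1 (true, true)) (bs ℓ0.1 ℓ1.1 (true, false)) (bs ℓ0.1 ℓ1.1 (false, true))
        (bs ℓ0.1 ℓ1.1 (false, false)) (fun k => cwVal ℓ0.2 ℓ1.2 k && (symVal b k == c)) := by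
  rw [← card_filter_cwOf ℓ0 ℓ1 (fun v k => v && (symVal b k == c))]
  congr 1
  ext u
  simp only [mem_filter, mem_univ, true_and, symWord_eq_symVal b ℓ0.1 ℓ1.1 u, Bool.and_eq_true, beq_iff_eq]

/-! ### Minimum distance from Boolean slices -/

/-- "weight `0` or `≥ d`". -/
def okDist (d v : ℕ) : Bool := Nat.beq v 0 || Nat.ble d v

/-- One `p`-slice of the minimum-distance check. -/
def distSliceB (m d p : ℕ) : Bool :=
  allTo (m + 1 - p) fun q => allTo (m + 1 - p - q) fun r =>
    okDist d (G4r p q r (m - p - q - r) fun k => cwVal false false k) &&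
    okDist d (G4r p q r (m - p - q - r) fun k => cwVal false true k) &&
    okDist d (G4r p q r (m - p - q - r) fun k => cwVal true false k) &&
    okDist d (G4r p q r (m - p - q - r) fun k => cwVal true true k)

/-- `okDist` certifies `d ≤ v` for non-zero `v`. -/
theorem okDist_spec {d v : ℕ} (h : okDist d v = true) (hv : v ≠ 0) : d ≤ v := by
  unfold okDist at h
  rw [Bool.or_eq_true, Nat.beq_eq, Nat.ble_eq] at h
  exact h.resolve_left hv

/-- **Minimum distance from the slices**: every non-zero codeword has weight `≥ d`. -/
theorem minWt_of_distSlices {m d : ℕ} (h : ∀ p ≤ m, distSliceB m d p = true) :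
    ∀ Q, IsElim1 m Q → pwt Q ≠ 0 → d ≤ pwt Q := by
  intro Q hQ hQ0
  obtain ⟨ℓ0, ℓ1, rfl⟩ := exists_cwOf hQ
  rw [pwt_cwOf, ← G4q_eq, ← G4r_eq] at hQ0 ⊢
  have hs := bs_sum ℓ0.1 ℓ1.1
  have h1 := allTo_spec (h (bs ℓ0.1 ℓ1.1 (true, true)) (by omega)) (bs ℓ0.1 ℓ1.1 (true, false)) (by omega)
  have h2 := allTo_spec h1 (bs ℓ0.1 ℓ1.1 (false, true)) (by omega)
  simp only [Bool.and_eq_true] at h2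
  rw [show m - bs ℓ0.1 ℓ1.1 (true, true) - bs ℓ0.1 ℓ1.1 (true, false) - bs ℓ0.1 ℓ1.1 (false, true) =
    bs ℓ0.1 ℓ1.1 (false, false) by omega] at h2
  obtain ⟨⟨⟨hff, hft⟩, htf⟩, htt⟩ := h2
  rcases ℓ0 with ⟨S0, a0⟩
  rcases ℓ1 with ⟨S1, a1⟩
  cases a0 <;> cases a1
  · exact okDist_spec hff hQ0
  · exact okDist_spec hft hQ0
  · exact okDist_spec htf hQ0
  · exact okDist_spec htt hQ0

/-! ### SC₁ with margin from Boolean slices -/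

/-- "weight `0`, or inside-count `+ σ ≤` outside-count". -/
def okMargin (σ w cin cout : ℕ) : Bool := Nat.beq w 0 || Nat.ble (cin + σ) cout

/-- One `p`-slice of the SC-margin check at `symWord m b`. -/
def marginSliceB (m σ : ℕ) (b : Bool) (p : ℕ) : Bool :=
  allTo (m + 1 - p) fun q => allTo (m + 1 - p - q) fun r =>
    (okMargin σ (G4r p q r (m - p - q - r) fun k => cwVal false false k)
      (G4r p q r (m - p - q - r) fun k => cwVal false false k && (symVal b k == false))
      (G4r p q r (m - p - q - r) fun k => cwVal false false k && (symVal b k == true))) &&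
    (okMargin σ (G4r p q r (m - p - q - r) fun k => cwVal false true k)
      (G4r p q r (m - p - q - r) fun k => cwVal false true k && (symVal b k == false))
      (G4r p q r (m - p - q - r) fun k => cwVal false true k && (symVal b k == true))) &&
    (okMargin σ (G4r p q r (m - p - q - r) fun k => cwVal true false k)
      (G4r p q r (m - p - q - r) fun k => cwVal true false k && (symVal b k == false))
      (G4r p q r (m - p - q - r) fun k => cwVal true false k && (symVal b k == true))) &&
    (okMargin σ (G4r p q r (m - p - q - r) fun k => cwVal true true k)
      (G4r p q r (m - p - q - r) fun k => cwVal true true k && (symVal b k == false))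
      (G4r p q r (m - p - q - r) fun k => cwVal true true k && (symVal b k == true)))

/-- `okMargin` certifies the margin inequality for non-zero weight. -/
theorem okMargin_spec {σ w cin cout : ℕ} (h : okMargin σ w cin cout = true) (hw : w ≠ 0) : cin + σ ≤ cout := by
  unfold okMargin at h
  rw [Bool.or_eq_true, Nat.beq_eq, Nat.ble_eq] at h
  exact h.resolve_left hw

/-- **SC₁ with margin from the slices.** -/
theorem scMargin_of_slices {m σ : ℕ} {b : Bool} (h : ∀ p ≤ m, marginSliceB m σ b p = true) :
    SCMargin m σ (symWord m b) := by
  intro A hA hA0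
  obtain ⟨ℓ0, ℓ1, rfl⟩ := exists_cwOf hA
  rw [card_overlap_cwOf, card_overlap_cwOf, ← G4q_eq, ← G4q_eq, ← G4r_eq, ← G4r_eq]
  rw [pwt_cwOf, ← G4q_eq, ← G4r_eq] at hA0
  have hs := bs_sum ℓ0.1 ℓ1.1
  have h1 := allTo_spec (h (bs ℓ0.1 ℓ1.1 (true, true)) (by omega)) (bs ℓ0.1 ℓ1.1 (true, false)) (by omega)
  have h2 := allTo_spec h1 (bs ℓ0.1 ℓ1.1 (false, true)) (by omega)
  simp only [Bool.and_eq_true] at h2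
  rw [show m - bs ℓ0.1 ℓ1.1 (true, true) - bs ℓ0.1 ℓ1.1 (true, false) - bs ℓ0.1 ℓ1.1 (false, true) =
    bs ℓ0.1 ℓ1.1 (false, false) by omega] at h2
  obtain ⟨⟨⟨hff, hft⟩, htf⟩, htt⟩ := h2
  rcases ℓ0 with ⟨S0, a0⟩
  rcases ℓ1 with ⟨S1, a1⟩
  cases a0 <;> cases a1
  · exact okMargin_spec hff hA0
  · exact okMargin_spec hft hA0
  · exact okMargin_spec htf hA0
  · exact okMargin_spec htt hA0

/-! ### `d(C_8) ≥ 58` -/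

/-- Slice `p = 0` of the distance check at `m = 8`. -/
theorem distSlice8_0 : distSliceB 8 58 0 = true := by decide +kernel
/-- Slice `p = 1` of the distance check at `m = 8`. -/
theorem distSlice8_1 : distSliceB 8 58 1 = true := by decide +kernel
/-- Slice `p = 2` of the distance check at `m = 8`. -/
theorem distSlice8_2 : distSliceB 8 58 2 = true := by decide +kernel
/-- Slice `p = 3` of the distance check at `m = 8`. -/
theorem distSlice8_3 : distSliceB 8 58 3 = true := by decide +kernel
/-- Slice `p = 4` of the distance check at `m = 8`. -/
theorem distSlice8_4 : distSliceB 8 58 4 = true := by decide +kernel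
/-- Slice `p = 5` of the distance check at `m = 8`. -/
theorem distSlice8_5 : distSliceB 8 58 5 = true := by decide +kernel
/-- Slice `p = 6` of the distance check at `m = 8`. -/
theorem distSlice8_6 : distSliceB 8 58 6 = true := by decide +kernel
/-- Slice `p = 7` of the distance check at `m = 8`. -/
theorem distSlice8_7 : distSliceB 8 58 7 = true := by decide +kernel
/-- Slice `p = 8` of the distance check at `m = 8`. -/
theorem distSlice8_8 : distSliceB 8 58 8 = true := by decide +kernel

/-- **`d(C_8) ≥ 58`**: every non-zero codeword of `C_8` has weight at least `58`. -/
theorem minWt_eight : ∀ Q, IsElim1 8 Q → pwt Q ≠ 0 → 58 ≤ pwt Q := by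
  refine minWt_of_distSlices fun p hp => ?_
  interval_cases p
  · exact distSlice8_0
  · exact distSlice8_1
  · exact distSlice8_2
  · exact distSlice8_3
  · exact distSlice8_4
  · exact distSlice8_5
  · exact distSlice8_6
  · exact distSlice8_7
  · exact distSlice8_8

/-! ### `d(C_9) ≥ 130` -/

/-- Slice `p = 0` of the distance check at `m = 9`. -/
theorem distSlice9_0 : distSliceB 9 130 0 = true := by decide +kernel
/-- Slice `p = 1` of the distance check at `m = 9`. -/
theorem distSlice9_1 : distSliceB 9 130 1 = true := by decide +kernel
/-- Slice `p = 2` of the distance check at `m = 9`. -/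
theorem distSlice9_2 : distSliceB 9 130 2 = true := by decide +kernel
/-- Slice `p = 3` of the distance check at `m = 9`. -/
theorem distSlice9_3 : distSliceB 9 130 3 = true := by decide +kernel
/-- Slice `p = 4` of the distance check at `m = 9`. -/
theorem distSlice9_4 : distSliceB 9 130 4 = true := by decide +kernel
/-- Slice `p = 5` of the distance check at `m = 9`. -/
theorem distSlice9_5 : distSliceB 9 130 5 = true := by decide +kernel
/-- Slice `p = 6` of the distance check at `m = 9`. -/
theorem distSlice9_6 : distSliceB 9 130 6 = true := by decide +kernel
/-- Slice `p = 7` of the distance check at `m = 9`. -/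
theorem distSlice9_7 : distSliceB 9 130 7 = true := by decide +kernel
/-- Slice `p = 8` of the distance check at `m = 9`. -/
theorem distSlice9_8 : distSliceB 9 130 8 = true := by decide +kernel
/-- Slice `p = 9` of the distance check at `m = 9`. -/
theorem distSlice9_9 : distSliceB 9 130 9 = true := by decide +kernel

/-- **`d(C_9) ≥ 130`**: every non-zero codeword of `C_9` has weight at least `130`. -/
theorem minWt_nine : ∀ Q, IsElim1 9 Q → pwt Q ≠ 0 → 130 ≤ pwt Q := by
  refine minWt_of_distSlices fun p hp => ?_
  interval_cases p
  · exact distSlice9_0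
  · exact distSlice9_1
  · exact distSlice9_2
  · exact distSlice9_3
  · exact distSlice9_4
  · exact distSlice9_5
  · exact distSlice9_6
  · exact distSlice9_7
  · exact distSlice9_8
  · exact distSlice9_9

/-! ### `d(C_15) ≥ 9829` -/

/-- Slice `p = 0` of the distance check at `m = 15`. -/
theorem distSlice15_0 : distSliceB 15 9829 0 = true := by decide +kernel
/-- Slice `p = 1` of the distance check at `m = 15`. -/
theorem distSlice15_1 : distSliceB 15 9829 1 = true := by decide +kernel
/-- Slice `p = 2` of the distance check at `m = 15`. -/
theorem distSlice15_2 : distSliceB 15 9829 2 = true := by decide +kernel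
/-- Slice `p = 3` of the distance check at `m = 15`. -/
theorem distSlice15_3 : distSliceB 15 9829 3 = true := by decide +kernel
/-- Slice `p = 4` of the distance check at `m = 15`. -/
theorem distSlice15_4 : distSliceB 15 9829 4 = true := by decide +kernel
/-- Slice `p = 5` of the distance check at `m = 15`. -/
theorem distSlice15_5 : distSliceB 15 9829 5 = true := by decide +kernel
/-- Slice `p = 6` of the distance check at `m = 15`. -/
theorem distSlice15_6 : distSliceB 15 9829 6 = true := by decide +kernel
/-- Slice `p = 7` of the distance check at `m = 15`. -/
theorem distSlice15_7 : distSliceB 15 9829 7 = true := by decide +kernel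
/-- Slice `p = 8` of the distance check at `m = 15`. -/
theorem distSlice15_8 : distSliceB 15 9829 8 = true := by decide +kernel
/-- Slice `p = 9` of the distance check at `m = 15`. -/
theorem distSlice15_9 : distSliceB 15 9829 9 = true := by decide +kernel
/-- Slice `p = 10` of the distance check at `m = 15`. -/
theorem distSlice15_10 : distSliceB 15 9829 10 = true := by decide +kernel
/-- Slice `p = 11` of the distance check at `m = 15`. -/
theorem distSlice15_11 : distSliceB 15 9829 11 = true := by decide +kernel
/-- Slice `p = 12` of the distance check at `m = 15`. -/
theorem distSlice15_12 : distSliceB 15 9829 12 = true := by decide +kernel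
/-- Slice `p = 13` of the distance check at `m = 15`. -/
theorem distSlice15_13 : distSliceB 15 9829 13 = true := by decide +kernel
/-- Slice `p = 14` of the distance check at `m = 15`. -/
theorem distSlice15_14 : distSliceB 15 9829 14 = true := by decide +kernel
/-- Slice `p = 15` of the distance check at `m = 15`. -/
theorem distSlice15_15 : distSliceB 15 9829 15 = true := by decide +kernel

/-- **`d(C_15) ≥ 9829`**: every non-zero codeword of `C_15` has weight at least `9829`. -/
theorem minWt_fifteen : ∀ Q, IsElim1 15 Q → pwt Q ≠ 0 → 9829 ≤ pwt Q := by
  refine minWt_of_distSlices fun p hp => ?_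
  interval_cases p
  · exact distSlice15_0
  · exact distSlice15_1
  · exact distSlice15_2
  · exact distSlice15_3
  · exact distSlice15_4
  · exact distSlice15_5
  · exact distSlice15_6
  · exact distSlice15_7
  · exact distSlice15_8
  · exact distSlice15_9
  · exact distSlice15_10
  · exact distSlice15_11
  · exact distSlice15_12
  · exact distSlice15_13
  · exact distSlice15_14
  · exact distSlice15_15

/-! ### SC₁ with margin `40` at `symWord 9 true` -/

/-- Slice `p = 0` of the margin check at `m = 9`. -/
theorem marginSlice9_0 : marginSliceB 9 40 true 0 = true := by decide +kernel
/-- Slice `p = 1` of the margin check at `m = 9`. -/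
theorem marginSlice9_1 : marginSliceB 9 40 true 1 = true := by decide +kernel
/-- Slice `p = 2` of the margin check at `m = 9`. -/
theorem marginSlice9_2 : marginSliceB 9 40 true 2 = true := by decide +kernel
/-- Slice `p = 3` of the margin check at `m = 9`. -/
theorem marginSlice9_3 : marginSliceB 9 40 true 3 = true := by decide +kernel
/-- Slice `p = 4` of the margin check at `m = 9`. -/
theorem marginSlice9_4 : marginSliceB 9 40 true 4 = true := by decide +kernel
/-- Slice `p = 5` of the margin check at `m = 9`. -/
theorem marginSlice9_5 : marginSliceB 9 40 true 5 = true := by decide +kernel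
/-- Slice `p = 6` of the margin check at `m = 9`. -/
theorem marginSlice9_6 : marginSliceB 9 40 true 6 = true := by decide +kernel
/-- Slice `p = 7` of the margin check at `m = 9`. -/
theorem marginSlice9_7 : marginSliceB 9 40 true 7 = true := by decide +kernel
/-- Slice `p = 8` of the margin check at `m = 9`. -/
theorem marginSlice9_8 : marginSliceB 9 40 true 8 = true := by decide +kernel
/-- Slice `p = 9` of the margin check at `m = 9`. -/
theorem marginSlice9_9 : marginSliceB 9 40 true 9 = true := by decide +kernel

/-- **`SCMargin 9 40 (symWord 9 true)`**: at the symmetric optimum every non-zero codeword has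
`|A ∖ Z| ≥ |A ∩ Z| + 40`. -/
theorem scMargin_nine : SCMargin 9 40 (symWord 9 true) := by
  refine scMargin_of_slices fun p hp => ?_
  interval_cases p
  · exact marginSlice9_0
  · exact marginSlice9_1
  · exact marginSlice9_2
  · exact marginSlice9_3
  · exact marginSlice9_4
  · exact marginSlice9_5
  · exact marginSlice9_6
  · exact marginSlice9_7
  · exact marginSlice9_8
  · exact marginSlice9_9

end SymCount

end Summit.QuantumAdvantage.AdviceFreeQNC0
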